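import Summits.BirchSwinnertonDyer.BirchSwinnertonDyer.Theorems.ManinLocalTwoThreeShimuraIndexAtTwo
import HarnessLib

/-!
# The Shimura index read at the prime `2` — §4: toward the Derickx–Orlić exponent question (E-es-193)

Sibling of `ManinLocalTwoThreeShimuraIndexAtTwo.lean` (es g42, MEMO-es §64; T-es-79, landed by LEAD prover p1 gen 23): the §4 of es g42's
`HOME/es/g42/ShimuraIndexAtTwo-es-g42.lean` (sha16 d13c2d598acd30d0) VERBATIM, split off for the 400-line rule.  For the newform `f` of a globally
minimal elliptic `W/ℚ` (`IsNewformOf W f`, any level): the two Eisenstein inputs at `2` in the exact shape consumed by es's rows E-es-211/212/213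
(`oddLevelEisensteinAtTwo`: `|a₂(W)| ≤ 2 ∧ (a₂(W) − 3)Λ₀(f) ⊆ Λ₁(f)` at odd level; `evenLevelEisensteinAtTwo`: `∃ e ∈ {0, ±1}, (e − 2)Λ₀(f) ⊆ Λ₁(f)`
at even level), and `two_mul_mem_or_three_mul_mem` — the Derickx–Orlić shape `2Λ₀(f) ⊆ Λ₁(f) ∨ 3Λ₀(f) ⊆ Λ₁(f)` UNCONDITIONALLY at even level and at
odd level with `a₂(W) ≥ 0`.  Route `ManinLocalTwoThree`, crux C2 `ManinOddAtFour` stmt-BirchSwinnertonDyer-22967 (helper).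

HONEST FRAMING: unconditional tree theorems (standard axioms); no definitions, no named facts, no sorry.  C2, C3, the Derickx–Orlić question in
general, Manin's conjecture and BSD are NOT proved by this file.
[cite: LingOesterle1991, Thm. 6] [cite: SilvermanAEC2009, Thm. V.1.1] [cite: AtkinLehner1970, Thm. 3] [cite: DerickxOrlic2025, Rmk. 4.8]
-/

set_option autoImplicit false
-- lint-debt: the directory name repeats the summit name (sibling precedent `ManinLocalTwoThreeShimuraIndexAtTwo.lean`)
set_option linter.dupNamespace false

noncomputable section

open scoped MatrixGroups ModularForm

open CongruenceSubgroup Complex WeierstrassCurve Literature.NumberTheory.EllipticCurves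
  Literature.NumberTheory.EllipticCurves.ModularForms
open Summit.BirchSwinnertonDyer.Rank1Residual.ManinAdditive.KatoCurve

namespace Summit.BirchSwinnertonDyer.BirchSwinnertonDyer.Theorems.ManinLocalTwoThree.ShimuraIndexAtTwo

section All

variable (W : WeierstrassCurve ℚ) [W.IsElliptic] [W.IsGloballyMinimal] {N : ℕ} [NeZero N]

/-! ### §4. Toward the Derickx–Orlić question (E-es-193 `exponent ∣ 2 ∨ exponent ∣ 3` at `N ≥ 18`): it HOLDS unconditionally
at even level and at odd level with `a₂(W) ≥ 0`; the residue is `2 ∤ N ∧ a₂(W) ∈ {−1, −2}` (rows E-es-211/212 of MEMO-es §64) -/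

/-- Membership bookkeeping: `c·z ∈ S` with `c ∈ {±1, ±2}` gives `2z ∈ S`. [folklore] -/
theorem two_mul_mem_of_intCast_mul_mem {S : AddSubgroup ℂ} {z : ℂ} {c : ℤ} (hc : c = -2 ∨ c = -1 ∨ c = 1 ∨ c = 2)
    (h : (c : ℂ) * z ∈ S) : 2 * z ∈ S := by
  rcases hc with rfl | rfl | rfl | rfl
  · have h' := S.neg_mem h
    convert h' using 1
    push_cast
    ring
  · have h1 : z ∈ S := by
      have h' := S.neg_mem h
      convert h' using 1
      push_cast
      ring
    convert S.add_mem h1 h1 using 1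
    ring
  · have h1 : z ∈ S := by
      convert h using 1
      push_cast
      ring
    convert S.add_mem h1 h1 using 1
    ring
  · convert h using 1
    push_cast
    ring

/-- Membership bookkeeping: `c·z ∈ S` with `c = ±3` gives `3z ∈ S`. [folklore] -/
theorem three_mul_mem_of_intCast_mul_mem {S : AddSubgroup ℂ} {z : ℂ} {c : ℤ} (hc : c = -3 ∨ c = 3)
    (h : (c : ℂ) * z ∈ S) : 3 * z ∈ S := by
  rcases hc with rfl | rfl
  · have h' := S.neg_mem h
    convert h' using 1
    push_cast
    ring
  · convert h using 1
    push_cast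
    ring

/-- The ODD-LEVEL EISENSTEIN INPUT AT `2`, in the exact shape consumed by `EsG42.exponentLeThreeMinimal_iff` (MEMO-es §64):
`|a₂(W)| ≤ 2 ∧ (a₂(W) − 3)Λ₀(f) ⊆ Λ₁(f)`. [cite: LingOesterle1991, Thm. 6] [cite: SilvermanAEC2009, Thm. V.1.1] -/
theorem oddLevelEisensteinAtTwo :
    ∀ (W : WeierstrassCurve ℚ) [W.IsElliptic] [W.IsGloballyMinimal] {N : ℕ} [NeZero N] (f : CuspForm (Gamma0 N) 2),
      IsNewformOf W f → ¬ 2 ∣ N →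
        |W.frobeniusTrace 2| ≤ 2 ∧ ∀ z ∈ periodLattice f, ((W.frobeniusTrace 2 - 3 : ℤ) : ℂ) * z ∈ periodLatticeGamma1 f :=
  fun W _ _ _ _ _ hf hN ↦ ⟨abs_frobeniusTrace_two_le_two W (hasGoodReductionAtPrime_two_of_not_two_dvd W hf hN),
    fun _ hz ↦ frobeniusTrace_two_sub_three_mul_mem W hf hN hz⟩

/-- The EVEN-LEVEL EISENSTEIN INPUT AT `2`, in the exact shape consumed by `EsG42.exponentLeThreeMinimal_iff`:
`∃ e ∈ {0, ±1}, (e − 2)Λ₀(f) ⊆ Λ₁(f)`. [cite: LingOesterle1991, Thm. 6] [cite: AtkinLehner1970, Thm. 3] -/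
theorem evenLevelEisensteinAtTwo :
    ∀ {N : ℕ} [NeZero N] (f : CuspForm (Gamma0 N) 2), IsNewform0 f → 2 ∣ N →
      ∃ e : ℤ, (e = 0 ∨ e = 1 ∨ e = -1) ∧ ∀ z ∈ periodLattice f, ((e - 2 : ℤ) : ℂ) * z ∈ periodLatticeGamma1 f := by
  intro N _ f hf hN
  obtain ⟨e, he, hcase⟩ := exists_cuspCoeff_two_eq_of_two_dvd hf hN
  refine ⟨e, ?_, fun z hz ↦ ?_⟩
  · rcases hcase with ⟨-, rfl⟩ | ⟨-, rfl | rfl⟩ <;> simp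
  · have h := sub_two_mul_mem_periodLatticeGamma1_of_two_dvd hf hN hz
    rw [he] at h
    exact_mod_cast h

/-- **E-es-193's conclusion holds UNCONDITIONALLY at even level and at odd level with `a₂(W) ≥ 0` (every `N`):**
`2Λ₀(f) ⊆ Λ₁(f) ∨ 3Λ₀(f) ⊆ Λ₁(f)`.  The residual cases are `2 ∤ N`, `a₂(W) = −1` (`4Λ₀ ⊆ Λ₁`; exponent `4` occurs at
`15a`, `17a`) and `a₂(W) = −2` (`5Λ₀ ⊆ Λ₁`; index `5` at `11a`).
[cite: LingOesterle1991, Thm. 6] [cite: SilvermanAEC2009, Thm. V.1.1] [cite: AtkinLehner1970, Thm. 3] -/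
theorem two_mul_mem_or_three_mul_mem {f : CuspForm (Gamma0 N) 2} (hf : IsNewformOf W f)
    (h : 2 ∣ N ∨ 0 ≤ W.frobeniusTrace 2) :
    (∀ z ∈ periodLattice f, 2 * z ∈ periodLatticeGamma1 f) ∨ (∀ z ∈ periodLattice f, 3 * z ∈ periodLatticeGamma1 f) := by
  by_cases hN : 2 ∣ N
  · obtain ⟨e, he, hmem⟩ := evenLevelEisensteinAtTwo f hf.1 hN
    rcases he with rfl | rfl | rfl
    · exact Or.inl fun z hz ↦ two_mul_mem_of_intCast_mul_mem (c := 0 - 2) (by norm_num) (hmem z hz)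
    · exact Or.inl fun z hz ↦ two_mul_mem_of_intCast_mul_mem (c := 1 - 2) (by norm_num) (hmem z hz)
    · exact Or.inr fun z hz ↦ three_mul_mem_of_intCast_mul_mem (c := -1 - 2) (by norm_num) (hmem z hz)
  · have ha : 0 ≤ W.frobeniusTrace 2 := h.resolve_left hN
    obtain ⟨habs, hmem⟩ := oddLevelEisensteinAtTwo W f hf hN
    have h2 := (abs_le.mp habs).2
    have hcases : W.frobeniusTrace 2 = 0 ∨ W.frobeniusTrace 2 = 1 ∨ W.frobeniusTrace 2 = 2 := by omega
    rcases hcases with h0 | h1 | h2'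
    · exact Or.inr fun z hz ↦ three_mul_mem_of_intCast_mul_mem (c := W.frobeniusTrace 2 - 3) (by omega) (hmem z hz)
    · exact Or.inl fun z hz ↦ two_mul_mem_of_intCast_mul_mem (c := W.frobeniusTrace 2 - 3) (by omega) (hmem z hz)
    · exact Or.inl fun z hz ↦ two_mul_mem_of_intCast_mul_mem (c := W.frobeniusTrace 2 - 3) (by omega) (hmem z hz)

/-- Datum form of the preceding theorem. [cite: LingOesterle1991, Thm. 6] [cite: SilvermanAEC2009, Thm. V.1.1] -/
theorem two_mul_mem_or_three_mul_mem_datum (D : ModularParametrizationData W N) (h : 2 ∣ N ∨ 0 ≤ W.frobeniusTrace 2) :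
    (∀ z ∈ periodLattice D.f, 2 * z ∈ periodLatticeGamma1 D.f) ∨ (∀ z ∈ periodLattice D.f, 3 * z ∈ periodLatticeGamma1 D.f) :=
  two_mul_mem_or_three_mul_mem W D.isNewformOf h

end All

end Summit.BirchSwinnertonDyer.BirchSwinnertonDyer.Theorems.ManinLocalTwoThree.ShimuraIndexAtTwo

end
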